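import Summits.AtomisticToContinuum.HydrodynamicLimit.Theses.DimensionLadder

/-!
# Line `EntropyLine` — birth skeleton for the crux `OneBodyMaxwellianAllDim` (stmt-AtomisticToContinuum-18864)

Route `route-AtomisticToContinuum-DimensionLadder`; the crux is ENGINE HALF 1 of the glued split of the deciding crux
`AllDimensionEuler` (stmt-9342) — identification of the ONE-BODY LAW: for every `d ≥ 3`, under the packing-guarded
hypotheses of the target, the one-particle marginal `F¹_N(t)` of the time-`t` density
`W_N(t) = 1_D · (canonical local-Gibbs density ∘ Φ_N(−t))` converges in `(1+|v|²)²`-weighted `L¹` to the local Maxwellian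
`ρ_t(x) M_{1,u_t(x),θ_t(x)}(v)` of the classical guarded hard-sphere Euler solution.
Strategist `planner-cstrat-stmt-AtomisticToContinuum-9342-r1-0`, 2026-08-17 (BC3 skeleton for the new piece).

## The line: RELATIVE ENTROPY (Yau 1991 / Olla–Varadhan–Yau 1993) + ENTROPY ⇒ ONE-BODY LAW (Kosygina 2001) + TAILS

The conclusion of the crux is reached from five registered stubs through the kernel-checked composition
`OneBodyMaxwellianAllDim_of`:

1. `stub_localGibbsEntropy : LocalGibbsEntropy` (XL, open — THE HARDEST STUB). Yau's relative-entropy estimate for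
   DETERMINISTIC hard spheres at fixed reduced density: for every packing level `η ≤ η₁(d)`, along every guarded classical
   Euler solution and every `t < T` there is an activity profile `b_t` (continuous, positive, `∫ b_t = 1`,
   `b_t σ^d < 2η`) such that (i) the canonical local Gibbs state `R_N[b_t, u_t, θ_t]` reproduces the Euler density
   (`R¹_N → ρ_t M_{u_t,θ_t}` in weighted `L¹` — local thermodynamics), and (ii) the SPECIFIC RELATIVE ENTROPY
   `H(W_N(t) | R_N[b_t,u_t,θ_t]) / (N+1) → 0`. Statement about the `N`-BODY law; says nothing about marginals by itself.
2. `stub_entropyToOneBody : EntropyToOneBody` (L; Kosygina-type transfer, GENERAL exchangeable densities `F_N`):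
   vanishing specific relative entropy with respect to a DILUTE canonical hard-sphere local Gibbs reference
   (`∫ b = 1`, `b σ^d < η₁(d)`: cluster-expansion regime), plus uniform integrability of the quartic velocity weight under
   `F¹_N`, transport the weighted-`L¹` limit of the REFERENCE one-marginal to `F¹_N`. (Block superadditivity of relative
   entropy + exponential mixing of the dilute reference + entropy inequality; then Csiszár–Kullback–Pinsker in the bulk
   `|v| ≤ R` and the tail hypothesis outside. No dynamics.)
3. `stub_velocityTails : VelocityTails` (M/L, open-ish; the `HighMomentumCutoffBarrier` issue, isolated): uniformly in
   `N` (eventually), the `(1+|v|²)²`-tail of `F¹_N(t)` beyond speed `R` is small for `R` large. NOT a consequence of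
   energy conservation or of `O(N)` entropy bounds (one sphere may carry speed `N^{1/4}` at entropy cost `o(N)`); a
   genuine dynamical input, and the reason the crux carries the squared weight.
4. `stub_timeDensityLaw : TimeDensityLaw` (M, provable now): for `σ < 1/2` the time-`t` density is measurable,
   nonnegative and has total mass `1` (packing: `N+1` spheres of diameter `σ(N+1)^{-1/d}` fit on a grid, so the
   canonical partition function is positive; Liouville measure preservation `HardSphereFlow.measurePreserving`).
5. `stub_flowRelabelSymmetry : FlowRelabelSymmetry` (M, provable now; = route support item stmt-9346 BY NAME):
   exchangeability of the time-`t` density.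

Composition (`OneBodyMaxwellianAllDim_of`, ≈ 35 tactic lines, sorry-free): thresholds
`η₀ := min (min η_e η_t) (η₁/2)` and `σ₀ := min (min σ_e σ_t) (1/2)`; the guard `ρ_t σ^d < η₀` feeds stub 1 at level
`η₀ ≤ η_e` and stub 3 at level `η_t`; stub 1's activity then satisfies `b σ^d < 2η₀ ≤ η₁`, the diluteness stub 2 wants;
continuity/positivity of `u_t, θ_t` from the classical solution; stubs 4–5 supply the density-law bookkeeping; stub 2
is applied to `F_N := W_N(t)` and `g := ρ_t M_{u_t,θ_t}`.

## Why no stub is the crux, the engine, or the summit (probes in `bc2/`, all must FAIL)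

* `LocalGibbsEntropy` is a statement about `N`-body relative entropy; without the transfer (2) and the tails (3) it yields
  no marginal convergence; conversely one-marginal convergence says nothing about `N`-body entropy. Incomparable with the
  crux; `↛ HydrodynamicLimit` (no LLN without a variance/chaos statement).
* `EntropyToOneBody`, `TimeDensityLaw`, `FlowRelabelSymmetry` contain no dynamics-to-Euler content at all.
* `VelocityTails` is strictly weaker than the crux (implied by it) and identifies no limit.

Barriers: `MacroErgodicityBarrier` bites stub 1 (Olla–Varadhan–Yau need noise for the one-block/local-ergodicity step;
for deterministic hard spheres it is the open core — the route's bet is that the top rung `d ≥ d₀` supplies the mixing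
through fresh grazing kicks, `FreshPartnerStatisticsR`); `HighMomentumCutoffBarrier` is confined to stub 3;
`NoDensityExpansionBarrier` does not apply (no density expansion of transport coefficients: Euler level, entropy method).
Disproof used: none exists for this crux. Dead lines: none registered.

[cite: OllaVaradhanYau1993, Thm. 1.1, §3] [cite: Spohn1991, Part I §3.2 (3.21)–(3.22)] [cite: Sznitman1991, Prop. 2.2]
-/

noncomputable section

namespace Summit.AtomisticToContinuum.HydrodynamicLimit.Cruxes.OneBodyMaxwellianAllDim.EntropyLine

open scoped BigOperators Topology Classical MeasureTheory InnerProductSpace ENNReal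
open Filter Set Function TopologicalSpace MeasureTheory InformationTheory
open Literature.MathematicalPhysics.KineticTheory Literature.Analysis.FluidPDE Literature.Analysis.FunctionSpaces
open Summit.AtomisticToContinuum.HydrodynamicLimit.Theses.DimensionLadder (OneBodyMaxwellianAllDim FlowRelabelSymmetry)

/-! ## Vocabulary (transparent abbreviations over Literature declarations) -/

/-- One-particle phase space `𝕋^d × ℝ^d`. -/
abbrev Pt (d : ℕ) : Type := UnitAddTorus (Fin d) × EuclideanSpace ℝ (Fin d)

/-- `(N+1)`-particle phase space. -/
abbrev Cfg (d N : ℕ) : Type := Config (N + 1) (Fin d) (UnitAddTorus (Fin d))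

/-- The time-`t` `(N+1)`-body density `W_N(t) = 1_D · (canonical local-Gibbs density ∘ Φ_N(−t))` of the crux. -/
abbrev timeDensity (d : ℕ) (σ : ℝ) (a₀ : UnitAddTorus (Fin d) → ℝ)
    (u₀ : UnitAddTorus (Fin d) → EuclideanSpace ℝ (Fin d)) (θ₀ : UnitAddTorus (Fin d) → ℝ) (N : ℕ)
    (Φ : HardSphereFlow (Torus.geometry (Fin d)) (hsDiameterDim d σ N) (N + 1)) (t : ℝ) : Cfg d N → ℝ :=
  (hardSphereDomain (Torus.geometry (Fin d)) (N + 1) (hsDiameterDim d σ N)).indicator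
    (hsTransport Φ t (canonicalDensity (Torus.geometry (Fin d)) (hsDiameterDim d σ N) (N + 1)
      (localGibbsProfileDim d a₀ u₀ θ₀)))

/-- The REFERENCE: canonical local Gibbs density of `N+1` hard spheres with activity `b`, velocity field `u'`,
temperature field `θ'` (same diameter `hsDiameterDim d σ N`). -/
abbrev refDensity (d : ℕ) (σ : ℝ) (b : UnitAddTorus (Fin d) → ℝ)
    (u' : UnitAddTorus (Fin d) → EuclideanSpace ℝ (Fin d)) (θ' : UnitAddTorus (Fin d) → ℝ) (N : ℕ) : Cfg d N → ℝ :=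
  canonicalDensity (Torus.geometry (Fin d)) (hsDiameterDim d σ N) (N + 1) (localGibbsProfileDim d b u' θ')

/-- The law `F dz` of a real density on `(N+1)`-particle phase space (negative part cut off). -/
abbrev lawOf {d N : ℕ} (F : Cfg d N → ℝ) : Measure (Cfg d N) :=
  (volume : Measure (Cfg d N)).withDensity fun z => ENNReal.ofReal (F z)

/-- SPECIFIC RELATIVE ENTROPY `H(F | R) / (N+1)` (Mathlib `klDiv`, `ℝ≥0∞`-valued: it is `∞` unless `F dz ≪ R dz` with
integrable log-likelihood ratio — no junk value can make a `Tendsto … (nhds 0)` clause vacuously true). -/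
abbrev specRelEnt {d N : ℕ} (F R : Cfg d N → ℝ) : ℝ≥0∞ :=
  klDiv (lawOf F) (lawOf R) / ((N : ℝ≥0∞) + 1)

/-- The one-particle marginal as a function on `Pt d` (the crux's `nthMarginal (N+1) 1 W (fun _ => y)`). -/
abbrev oneMarginal {d N : ℕ} (F : Cfg d N → ℝ) (y : Pt d) : ℝ :=
  nthMarginal (N + 1) 1 F (fun _ => y)

/-- `(1+|v|²)²`-weighted `L¹` distance of one-body functions (the crux's norm). -/
abbrev wDist (d : ℕ) (f g : Pt d → ℝ) : ℝ≥0∞ :=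
  ∫⁻ y, ENNReal.ofReal ((1 + ‖y.2‖ ^ 2) ^ 2 * |f y - g y|)

/-- `(1+|v|²)²`-weighted velocity TAIL of a one-body function beyond speed `R`. -/
abbrev wTail (d : ℕ) (R : ℝ) (f : Pt d → ℝ) : ℝ≥0∞ :=
  ∫⁻ y in {y : Pt d | R < ‖y.2‖}, ENNReal.ofReal ((1 + ‖y.2‖ ^ 2) ^ 2 * f y)

/-! ## Stub statements -/

/-- STUB 1 statement — YAU'S RELATIVE-ENTROPY ESTIMATE for deterministic hard spheres at fixed reduced density, every
`d ≥ 3`, parametrised by the packing level `η ≤ η₁(d)`: along a guarded classical hard-sphere Euler solution, for every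
`t < T` there is an activity profile `b` (continuous, positive, unit mass, `b σ^d < 2η`) whose canonical local Gibbs
state with the Euler velocity/temperature fields `(u_t, θ_t)` (i) has one-marginal converging in `(1+|v|²)²`-weighted
`L¹` to `ρ_t M_{1,u_t,θ_t}` and (ii) is at specific relative entropy `o(1)` from the true time-`t` law. -/
def LocalGibbsEntropy : Prop :=
  ∀ d : ℕ, 3 ≤ d → ∃ η₁ : ℝ, 0 < η₁ ∧ ∀ η : ℝ, 0 < η → η ≤ η₁ →
    ∀ (a₀ θ₀ : UnitAddTorus (Fin d) → ℝ) (u₀ : UnitAddTorus (Fin d) → EuclideanSpace ℝ (Fin d)),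
      Continuous a₀ → Continuous θ₀ → Continuous u₀ → (∀ x, 0 < a₀ x) → (∀ x, 0 < θ₀ x) →
    ∃ σ₀ : ℝ, 0 < σ₀ ∧ ∀ σ : ℝ, 0 < σ → σ < σ₀ →
    ∀ (T : ℝ) (ρ θ : ℝ → UnitAddTorus (Fin d) → ℝ) (u : ℝ → UnitAddTorus (Fin d) → EuclideanSpace ℝ (Fin d)),
      IsHardSphereEulerSolutionDim d σ T ρ u θ → (∀ t ∈ Set.Ico 0 T, ∀ x, ρ t x * σ ^ d < η) →
    ∀ Φ : (N : ℕ) → HardSphereFlow (Torus.geometry (Fin d)) (hsDiameterDim d σ N) (N + 1),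
      TendstoHydroFieldsAtDim d (fun N => localGibbsLawDim d σ a₀ u₀ θ₀ N (Φ N)) Φ ρ u θ 0 →
    ∀ t ∈ Set.Ico 0 T, ∃ b : UnitAddTorus (Fin d) → ℝ,
      Continuous b ∧ (∀ x, 0 < b x) ∧ (∫ x, b x = 1) ∧ (∀ x, b x * σ ^ d < 2 * η) ∧
      Tendsto (fun N : ℕ => wDist d (oneMarginal (refDensity d σ b (u t) (θ t) N))
        (localGibbsProfileDim d (ρ t) (u t) (θ t))) atTop (nhds 0) ∧
      Tendsto (fun N : ℕ => specRelEnt (timeDensity d σ a₀ u₀ θ₀ N (Φ N) t) (refDensity d σ b (u t) (θ t) N))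
        atTop (nhds 0)

/-- STUB 2 statement — ENTROPY ⇒ ONE-BODY LAW (Kosygina-type transfer, general exchangeable densities): in the dilute
regime `b σ^d < η₁(d)` of the canonical hard-sphere local Gibbs reference, vanishing specific relative entropy plus
uniform integrability of the quartic velocity weight under `F¹_N` transport the weighted-`L¹` limit `g` of the reference
one-marginal to `F¹_N`. -/
def EntropyToOneBody : Prop :=
  ∀ d : ℕ, 3 ≤ d → ∃ η₁ : ℝ, 0 < η₁ ∧
    ∀ (σ : ℝ) (b θ' : UnitAddTorus (Fin d) → ℝ) (u' : UnitAddTorus (Fin d) → EuclideanSpace ℝ (Fin d)),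
      0 < σ → Continuous b → Continuous θ' → Continuous u' → (∀ x, 0 < b x) → (∀ x, 0 < θ' x) →
      (∫ x, b x = 1) → (∀ x, b x * σ ^ d < η₁) →
    ∀ F : (N : ℕ) → Cfg d N → ℝ,
      (∀ N, Measurable (F N)) → (∀ N z, 0 ≤ F N z) → (∀ N, ∫ z, F N z = 1) →
      (∀ (N : ℕ) (π : Equiv.Perm (Fin (N + 1))), (fun z : Cfg d N => F N (z ∘ π)) =ᵐ[volume] F N) →
      Tendsto (fun N : ℕ => specRelEnt (F N) (refDensity d σ b u' θ' N)) atTop (nhds 0) →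
      (∀ κ : ℝ, 0 < κ → ∃ R : ℝ, ∀ᶠ N : ℕ in atTop, wTail d R (oneMarginal (F N)) ≤ ENNReal.ofReal κ) →
    ∀ g : Pt d → ℝ,
      Tendsto (fun N : ℕ => wDist d (oneMarginal (refDensity d σ b u' θ' N)) g) atTop (nhds 0) →
      Tendsto (fun N : ℕ => wDist d (oneMarginal (F N)) g) atTop (nhds 0)

/-- STUB 3 statement — VELOCITY TAILS: under the crux's guarded hypotheses, for every `t < T` the `(1+|v|²)²`-weighted
tail of the one-particle marginal of the time-`t` law beyond speed `R` is, eventually in `N`, smaller than any `κ > 0`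
once `R` is large (uniform integrability of the quartic velocity weight). -/
def VelocityTails : Prop :=
  ∀ d : ℕ, 3 ≤ d → ∃ η₀ : ℝ, 0 < η₀ ∧
    ∀ (a₀ θ₀ : UnitAddTorus (Fin d) → ℝ) (u₀ : UnitAddTorus (Fin d) → EuclideanSpace ℝ (Fin d)),
      Continuous a₀ → Continuous θ₀ → Continuous u₀ → (∀ x, 0 < a₀ x) → (∀ x, 0 < θ₀ x) →
    ∃ σ₀ : ℝ, 0 < σ₀ ∧ ∀ σ : ℝ, 0 < σ → σ < σ₀ →
    ∀ (T : ℝ) (ρ θ : ℝ → UnitAddTorus (Fin d) → ℝ) (u : ℝ → UnitAddTorus (Fin d) → EuclideanSpace ℝ (Fin d)),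
      IsHardSphereEulerSolutionDim d σ T ρ u θ → (∀ t ∈ Set.Ico 0 T, ∀ x, ρ t x * σ ^ d < η₀) →
    ∀ Φ : (N : ℕ) → HardSphereFlow (Torus.geometry (Fin d)) (hsDiameterDim d σ N) (N + 1),
      TendstoHydroFieldsAtDim d (fun N => localGibbsLawDim d σ a₀ u₀ θ₀ N (Φ N)) Φ ρ u θ 0 →
    ∀ t ∈ Set.Ico 0 T, ∀ κ : ℝ, 0 < κ → ∃ R : ℝ, ∀ᶠ N : ℕ in atTop,
      wTail d R (oneMarginal (timeDensity d σ a₀ u₀ θ₀ N (Φ N) t)) ≤ ENNReal.ofReal κ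

/-- STUB 4 statement — DENSITY-LAW BOOKKEEPING (provable now): for `0 < σ < 1/2` (so that `N+1` spheres of diameter
`σ(N+1)^{-1/d}` fit on the unit torus and the canonical partition function is positive) the time-`t` density is
measurable, nonnegative and of total mass one (`HardSphereFlow.measurable_flow`, `.measurePreserving`). -/
def TimeDensityLaw : Prop :=
  ∀ d : ℕ, 3 ≤ d → ∀ (σ : ℝ) (a₀ θ₀ : UnitAddTorus (Fin d) → ℝ) (u₀ : UnitAddTorus (Fin d) → EuclideanSpace ℝ (Fin d)),
    0 < σ → σ < 1 / 2 → Continuous a₀ → Continuous θ₀ → Continuous u₀ → (∀ x, 0 < a₀ x) → (∀ x, 0 < θ₀ x) →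
    ∀ (N : ℕ) (Φ : HardSphereFlow (Torus.geometry (Fin d)) (hsDiameterDim d σ N) (N + 1)) (t : ℝ),
      Measurable (timeDensity d σ a₀ u₀ θ₀ N Φ t) ∧ (∀ z, 0 ≤ timeDensity d σ a₀ u₀ θ₀ N Φ t z) ∧
        ∫ z, timeDensity d σ a₀ u₀ θ₀ N Φ t z = 1

/-! ## The registered stubs -/

/-- STUB 1 (XL, open) — Yau's relative-entropy estimate, deterministic hard spheres, every `d ≥ 3`. -/
theorem stub_localGibbsEntropy : LocalGibbsEntropy := by
  sorry

/-- STUB 2 (L) — specific relative entropy `o(1)` w.r.t. a dilute local Gibbs reference ⇒ one-body law (Kosygina-type). -/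
theorem stub_entropyToOneBody : EntropyToOneBody := by
  sorry

/-- STUB 3 (M/L) — uniform integrability of the quartic velocity weight under the one-particle marginal at time `t`. -/
theorem stub_velocityTails : VelocityTails := by
  sorry

/-- STUB 4 (M, provable now) — measurability, positivity and unit mass of the time-`t` density for `σ < 1/2`. -/
theorem stub_timeDensityLaw : TimeDensityLaw := by
  sorry

/-- STUB 5 (M, provable now; = route support item stmt-AtomisticToContinuum-9346 BY NAME) — exchangeability. -/
theorem stub_flowRelabelSymmetry : FlowRelabelSymmetry := by
  sorry

/-! ## The composition -/

/-- **THE COMPOSITION** — the crux `DimensionLadder.OneBodyMaxwellianAllDim` BY NAME from the five registered stubs. -/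
theorem OneBodyMaxwellianAllDim_of : OneBodyMaxwellianAllDim := by
  intro d hd
  obtain ⟨η₁, hη₁, K⟩ := (stub_entropyToOneBody : EntropyToOneBody) d hd
  obtain ⟨ηe, hηe, E⟩ := (stub_localGibbsEntropy : LocalGibbsEntropy) d hd
  obtain ⟨ηt, hηt, Tl⟩ := (stub_velocityTails : VelocityTails) d hd
  have hη₀pos : 0 < min (min ηe ηt) (η₁ / 2) := lt_min (lt_min hηe hηt) (half_pos hη₁)
  have hη₀e : min (min ηe ηt) (η₁ / 2) ≤ ηe := le_trans (min_le_left _ _) (min_le_left _ _)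
  have hη₀t : min (min ηe ηt) (η₁ / 2) ≤ ηt := le_trans (min_le_left _ _) (min_le_right _ _)
  have hη₀1 : 2 * min (min ηe ηt) (η₁ / 2) ≤ η₁ := by
    have h := min_le_right (min ηe ηt) (η₁ / 2)
    linarith
  refine ⟨min (min ηe ηt) (η₁ / 2), hη₀pos, ?_⟩
  intro a₀ θ₀ u₀ ha hθ hu ha0 hθ0
  obtain ⟨σe, hσe, E'⟩ := E (min (min ηe ηt) (η₁ / 2)) hη₀pos hη₀e a₀ θ₀ u₀ ha hθ hu ha0 hθ0
  obtain ⟨σt, hσt, T'⟩ := Tl a₀ θ₀ u₀ ha hθ hu ha0 hθ0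
  refine ⟨min (min σe σt) (1 / 2), lt_min (lt_min hσe hσt) one_half_pos, ?_⟩
  intro σ hσ hσlt T ρ θ u hsol hguard Φ h0 t ht
  have hσe' : σ < σe := lt_of_lt_of_le hσlt (le_trans (min_le_left _ _) (min_le_left _ _))
  have hσt' : σ < σt := lt_of_lt_of_le hσlt (le_trans (min_le_left _ _) (min_le_right _ _))
  have hσh : σ < 1 / 2 := lt_of_lt_of_le hσlt (min_le_right _ _)
  have hguard_t : ∀ s ∈ Set.Ico 0 T, ∀ x, ρ s x * σ ^ d < ηt :=
    fun s hs x => lt_of_lt_of_le (hguard s hs x) hη₀t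
  obtain ⟨b, hbc, hbpos, hb1, hbg, hcons, hent⟩ := E' σ hσ hσe' T ρ θ u hsol hguard Φ h0 t ht
  have htail := T' σ hσ hσt' T ρ θ u hsol hguard_t Φ h0 t ht
  have hθc : Continuous (θ t) := (hsol.smooth_temperature.isSmooth_slice ht).continuous
  have huc : Continuous (u t) := (hsol.smooth_velocity.isSmooth_slice ht).continuous
  have hθpos : ∀ x, 0 < θ t x := hsol.temperature_pos t ht
  have hbg' : ∀ x, b x * σ ^ d < η₁ := fun x => lt_of_lt_of_le (hbg x) hη₀1
  have hlaw := fun N : ℕ =>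
    (stub_timeDensityLaw : TimeDensityLaw) d hd σ a₀ θ₀ u₀ hσ hσh ha hθ hu ha0 hθ0 N (Φ N) t
  have hsymm : ∀ (N : ℕ) (π : Equiv.Perm (Fin (N + 1))),
      (fun z : Cfg d N => timeDensity d σ a₀ u₀ θ₀ N (Φ N) t (z ∘ π)) =ᵐ[volume]
        timeDensity d σ a₀ u₀ θ₀ N (Φ N) t :=
    fun N π => (stub_flowRelabelSymmetry : FlowRelabelSymmetry) d hd σ a₀ θ₀ u₀ Φ t N π hσ
  exact K σ b (θ t) (u t) hσ hbc hθc huc hbpos hθpos hb1 hbg' (fun N => timeDensity d σ a₀ u₀ θ₀ N (Φ N) t)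
    (fun N => (hlaw N).1) (fun N => (hlaw N).2.1) (fun N => (hlaw N).2.2) hsymm hent htail
    (localGibbsProfileDim d (ρ t) (u t) (θ t)) hcons

end Summit.AtomisticToContinuum.HydrodynamicLimit.Cruxes.OneBodyMaxwellianAllDim.EntropyLine

end
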